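import Mathlib
import Literature.Barriers.MatrixMultiplication.NormalizerBarrier
import Summits.MatrixMultiplication.MatrixMultiplication.Theorems.SubgroupIdentityDesigns.Negative.GlobalRelations
import Summits.MatrixMultiplication.MatrixMultiplication.Theorems.SubgroupIdentityDesigns.Negative.TwoRankCriterion

/-!
# The standard line representatives of `𝔽_p²` and the PAIR WALLS of the census, hypothesis-free (negative-side lemma for the crux
`SubgroupIdentityDesigns`, stmt-MatrixMultiplication-14079; cell B2b-5, gen 8 — report `run/shared/lean/b2b/levelgraded-cu/ORACLE-g8.md` §G8-1)

`GlobalRelations.no_levelOne_design_of_rank` is stated for an abstract family of line representatives `u : L → 𝔽_p²` (non-zero, pairwise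
non-proportional, covering).  Here the STANDARD family `(j,1)` (`j ∈ 𝔽_p`), `(1,0)` — the one the census engine and the engine-free verifiers use —
is shown to qualify (`standardLines_cover`, `standardLines_ne_zero`, `standardLines_inj`), with `|L| = p + 1` and `|L × {w ≠ 0}| = (p+1)(p²-1)`
rows, and the rank term is dropped to obtain the enumeration's WALLS as theorems: if two of the three subgroups meet trivially and the product
of their orders exceeds `(p+1)(p²-1) - 2p = 1 + p² + (p-2)(p+1)²` (`1418` for `p = 11`), the identity-design clause fails at `(m,k) = (2,1)` —
for the pair `(H₁,H₃)` directly (`T = H₁H₃ ⊆ S`), for `(H₁,H₂)` and `(H₂,H₃)` after restricting the clause to `g = 1`, resp. `a = 1`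
(`design_restrict₁₂`, `design_restrict₂₃`).  So the census's wall `|Hᵢ||Hⱼ| ≤ 1418` discards only triples refuted by an in-tree theorem.
The PAIR TABLE that prunes the enumeration is covered the same way: a FAIL certificate (ghost / FL / exact) for the pseudo-triple `(Hᵢ,1,Hⱼ)`
refutes every triple with that pair in that position (`design_restrict₁₃`, `design_restrict₁₂`, `design_restrict₂₃`, `no_levelOne_design_of_pair`).
Also the two rank criteria with the standard family and the row counts evaluated — the literal form the engine-free verifiers check
(`verify_rank.py`: `(p+1)(p²-1) < |T| + rank_F + 2p`; `verify_lker.py`: `(p+1)(p²-1) < |T| + rank_F + k` with `k` certified independent global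
integer relations): `no_levelOne_design_of_rank_std`, `no_levelOne_design_of_twoRank_std`.
Sorry-free.  VALUE = soundness theorem for the census semantics (decidable-verdict infrastructure), NOT summit progress.
-/

set_option linter.dupNamespace false

noncomputable section

open scoped BigOperators Classical
open Matrix
open Summit.MatrixMultiplication.MatrixMultiplication.Theorems.LieRankDesigns.Negative (GLm Mat)

namespace Summit.MatrixMultiplication.MatrixMultiplication.Theorems.SubgroupIdentityDesigns.Negative

namespace StandardLines

variable {p : ℕ} [Fact p.Prime]

/-- The standard line representatives: `some j ↦ (j,1)`, `none ↦ (1,0)`. -/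
theorem standardLines_ne_zero (o : Option (ZMod p)) :
    (o.elim ![1, 0] fun j => ![j, 1] : Fin 2 → ZMod p) ≠ 0 := by
  cases o with
  | none => intro h; have := congrFun h 0; simp at this
  | some j => intro h; have := congrFun h 1; simp at this

/-- The standard representatives are pairwise non-proportional. -/
theorem standardLines_inj (o o' : Option (ZMod p)) (c : ZMod p)
    (h : (o.elim ![1, 0] fun j => ![j, 1] : Fin 2 → ZMod p) = c • (o'.elim ![1, 0] fun j => ![j, 1])) : o = o' := by
  cases o with
  | none =>
    cases o' with
    | none => rfl
    | some j' =>
      have h1 := congrFun h 1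
      have h0 := congrFun h 0
      simp at h0 h1
      rw [← h1] at h0; simp at h0
  | some j =>
    cases o' with
    | none =>
      have h1 := congrFun h 1
      simp at h1
    | some j' =>
      have h1 := congrFun h 1
      have h0 := congrFun h 0
      simp at h0 h1
      rw [← h1, one_mul] at h0
      rw [h0]

/-- Every non-zero vector of `𝔽_p²` is a non-zero multiple of a standard representative. -/
theorem standardLines_cover (a : Fin 2 → ZMod p) (ha : a ≠ 0) :
    ∃ o : Option (ZMod p), ∃ c : ZMod p, c ≠ 0 ∧ a = c • (o.elim ![1, 0] fun j => ![j, 1]) := by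
  by_cases h1 : a 1 = 0
  · have h0 : a 0 ≠ 0 := by
      intro h0; apply ha; funext i; fin_cases i <;> simp [h0, h1]
    refine ⟨none, a 0, h0, ?_⟩
    funext i; fin_cases i <;> simp [h1]
  · refine ⟨some (a 0 / a 1), a 1, h1, ?_⟩
    funext i; fin_cases i
    · simp [mul_div_cancel₀ _ h1]
    · simp

/-- The line-row index set `L × {w ≠ 0}` has `(p+1)(p²-1)` elements (`1440` for `p = 11`). -/
theorem card_rows : Fintype.card (Option (ZMod p) × {w : Fin 2 → ZMod p // w ≠ 0}) = (p + 1) * (p ^ 2 - 1) := by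
  rw [Fintype.card_prod, Fintype.card_option, ZMod.card, Fintype.card_subtype_compl, Fintype.card_subtype_eq,
    Fintype.card_fun, ZMod.card, Fintype.card_fin]

/-- Restricting the identity-design clause of `(H₁,H₂,H₃)` to `g = 1` gives the clause of `(H₁,⊥,H₂)`. -/
theorem design_restrict₁₂ (H₁ H₂ H₃ : Subgroup (GLm p 2))
    (h : ∃ c : Matrix (Fin 2) (Fin 2) (ZMod p) → ℂ, (∀ M, 1 < M.rank → c M = 0) ∧
      (∑ M, c M * ZMod.stdAddChar (Matrix.trace (M * ((1 : GLm p 2) : Mat p 2)))) = 1 ∧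
      ∀ a ∈ H₁, ∀ b ∈ H₂, ∀ g ∈ H₃, a * b * g ≠ 1 →
        (∑ M, c M * ZMod.stdAddChar (Matrix.trace (M * ((a * b * g : GLm p 2) : Mat p 2)))) = 0) :
    ∃ c : Matrix (Fin 2) (Fin 2) (ZMod p) → ℂ, (∀ M, 1 < M.rank → c M = 0) ∧
      (∑ M, c M * ZMod.stdAddChar (Matrix.trace (M * ((1 : GLm p 2) : Mat p 2)))) = 1 ∧
      ∀ a ∈ H₁, ∀ b ∈ (⊥ : Subgroup (GLm p 2)), ∀ g ∈ H₂, a * b * g ≠ 1 →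
        (∑ M, c M * ZMod.stdAddChar (Matrix.trace (M * ((a * b * g : GLm p 2) : Mat p 2)))) = 0 := by
  obtain ⟨c, hc, h1, h0⟩ := h
  refine ⟨c, hc, h1, ?_⟩
  intro a ha b hb g hg hne
  rw [Subgroup.mem_bot] at hb
  subst hb
  have h' := h0 a ha g hg 1 H₃.one_mem
  simp only [mul_one] at h' hne ⊢
  exact h' hne

/-- Restricting the identity-design clause of `(H₁,H₂,H₃)` to `a = 1` gives the clause of `(H₂,⊥,H₃)`. -/
theorem design_restrict₂₃ (H₁ H₂ H₃ : Subgroup (GLm p 2))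
    (h : ∃ c : Matrix (Fin 2) (Fin 2) (ZMod p) → ℂ, (∀ M, 1 < M.rank → c M = 0) ∧
      (∑ M, c M * ZMod.stdAddChar (Matrix.trace (M * ((1 : GLm p 2) : Mat p 2)))) = 1 ∧
      ∀ a ∈ H₁, ∀ b ∈ H₂, ∀ g ∈ H₃, a * b * g ≠ 1 →
        (∑ M, c M * ZMod.stdAddChar (Matrix.trace (M * ((a * b * g : GLm p 2) : Mat p 2)))) = 0) :
    ∃ c : Matrix (Fin 2) (Fin 2) (ZMod p) → ℂ, (∀ M, 1 < M.rank → c M = 0) ∧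
      (∑ M, c M * ZMod.stdAddChar (Matrix.trace (M * ((1 : GLm p 2) : Mat p 2)))) = 1 ∧
      ∀ a ∈ H₂, ∀ b ∈ (⊥ : Subgroup (GLm p 2)), ∀ g ∈ H₃, a * b * g ≠ 1 →
        (∑ M, c M * ZMod.stdAddChar (Matrix.trace (M * ((a * b * g : GLm p 2) : Mat p 2)))) = 0 := by
  obtain ⟨c, hc, h1, h0⟩ := h
  refine ⟨c, hc, h1, ?_⟩
  intro b hb x hx g hg hne
  rw [Subgroup.mem_bot] at hx
  subst hx
  have h' := h0 1 H₁.one_mem b hb g hg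
  simp only [mul_one, one_mul] at h' hne ⊢
  exact h' hne

/-- Restricting the identity-design clause of `(H₁,H₂,H₃)` to `b = 1` gives the clause of `(H₁,⊥,H₃)`: a FAIL certificate for the PAIR set
`H₁H₃` (the census pair table, read as the pseudo-triple `(H₁,1,H₃)`) refutes every triple with that outer pair. -/
theorem design_restrict₁₃ (H₁ H₂ H₃ : Subgroup (GLm p 2))
    (h : ∃ c : Matrix (Fin 2) (Fin 2) (ZMod p) → ℂ, (∀ M, 1 < M.rank → c M = 0) ∧
      (∑ M, c M * ZMod.stdAddChar (Matrix.trace (M * ((1 : GLm p 2) : Mat p 2)))) = 1 ∧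
      ∀ a ∈ H₁, ∀ b ∈ H₂, ∀ g ∈ H₃, a * b * g ≠ 1 →
        (∑ M, c M * ZMod.stdAddChar (Matrix.trace (M * ((a * b * g : GLm p 2) : Mat p 2)))) = 0) :
    ∃ c : Matrix (Fin 2) (Fin 2) (ZMod p) → ℂ, (∀ M, 1 < M.rank → c M = 0) ∧
      (∑ M, c M * ZMod.stdAddChar (Matrix.trace (M * ((1 : GLm p 2) : Mat p 2)))) = 1 ∧
      ∀ a ∈ H₁, ∀ b ∈ (⊥ : Subgroup (GLm p 2)), ∀ g ∈ H₃, a * b * g ≠ 1 →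
        (∑ M, c M * ZMod.stdAddChar (Matrix.trace (M * ((a * b * g : GLm p 2) : Mat p 2)))) = 0 := by
  obtain ⟨c, hc, h1, h0⟩ := h
  refine ⟨c, hc, h1, ?_⟩
  intro a ha b hb g hg hne
  rw [Subgroup.mem_bot] at hb
  subst hb
  have h' := h0 a ha 1 H₂.one_mem g hg
  simp only [mul_one] at h' hne ⊢
  exact h' hne

/-- The three pair positions at once: if the clause fails for the pseudo-triples built from the pair sets `H₁H₃`, `H₁H₂` or `H₂H₃`
(any one of them), it fails for `(H₁,H₂,H₃)` — the soundness of pruning the census enumeration by the pair table. -/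
theorem no_levelOne_design_of_pair (H₁ H₂ H₃ : Subgroup (GLm p 2))
    (h : (¬ ∃ c : Matrix (Fin 2) (Fin 2) (ZMod p) → ℂ, (∀ M, 1 < M.rank → c M = 0) ∧
      (∑ M, c M * ZMod.stdAddChar (Matrix.trace (M * ((1 : GLm p 2) : Mat p 2)))) = 1 ∧
      ∀ a ∈ H₁, ∀ b ∈ (⊥ : Subgroup (GLm p 2)), ∀ g ∈ H₃, a * b * g ≠ 1 →
        (∑ M, c M * ZMod.stdAddChar (Matrix.trace (M * ((a * b * g : GLm p 2) : Mat p 2)))) = 0) ∨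
      (¬ ∃ c : Matrix (Fin 2) (Fin 2) (ZMod p) → ℂ, (∀ M, 1 < M.rank → c M = 0) ∧
      (∑ M, c M * ZMod.stdAddChar (Matrix.trace (M * ((1 : GLm p 2) : Mat p 2)))) = 1 ∧
      ∀ a ∈ H₁, ∀ b ∈ (⊥ : Subgroup (GLm p 2)), ∀ g ∈ H₂, a * b * g ≠ 1 →
        (∑ M, c M * ZMod.stdAddChar (Matrix.trace (M * ((a * b * g : GLm p 2) : Mat p 2)))) = 0) ∨
      (¬ ∃ c : Matrix (Fin 2) (Fin 2) (ZMod p) → ℂ, (∀ M, 1 < M.rank → c M = 0) ∧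
      (∑ M, c M * ZMod.stdAddChar (Matrix.trace (M * ((1 : GLm p 2) : Mat p 2)))) = 1 ∧
      ∀ a ∈ H₂, ∀ b ∈ (⊥ : Subgroup (GLm p 2)), ∀ g ∈ H₃, a * b * g ≠ 1 →
        (∑ M, c M * ZMod.stdAddChar (Matrix.trace (M * ((a * b * g : GLm p 2) : Mat p 2)))) = 0)) :
    ¬ ∃ c : Matrix (Fin 2) (Fin 2) (ZMod p) → ℂ, (∀ M, 1 < M.rank → c M = 0) ∧
      (∑ M, c M * ZMod.stdAddChar (Matrix.trace (M * ((1 : GLm p 2) : Mat p 2)))) = 1 ∧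
      ∀ a ∈ H₁, ∀ b ∈ H₂, ∀ g ∈ H₃, a * b * g ≠ 1 →
        (∑ M, c M * ZMod.stdAddChar
          (Matrix.trace (M * ((a * b * g : GLm p 2) : Mat p 2)))) = 0 := by
  intro hd
  rcases h with h13 | h12 | h23
  · exact h13 (design_restrict₁₃ H₁ H₂ H₃ hd)
  · exact h12 (design_restrict₁₂ H₁ H₂ H₃ hd)
  · exact h23 (design_restrict₂₃ H₁ H₂ H₃ hd)

/-- `GlobalRelations.no_levelOne_design_of_rank` with the standard line family and the counts `|L| = p+1`, `|L × {w ≠ 0}| = (p+1)(p²-1)`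
evaluated: the literal FR check of `verify_rank.py`. -/
theorem no_levelOne_design_of_rank_std (H₁ H₂ H₃ : Subgroup (GLm p 2))
    (T : Finset {s : CMat p 2 // ∃ a ∈ H₁, ∃ b ∈ H₂, ∃ g ∈ H₃, s = ((a * b * g : GLm p 2) : Mat p 2)})
    (hT : ∀ x ∈ T, ∃ a₀ ∈ H₁, ∃ g₀ ∈ H₃, (x : CMat p 2) = ((a₀ * g₀ : GLm p 2) : Mat p 2))
    (F : Type*) [Field F]
    (hlt : (p + 1) * (p ^ 2 - 1) <
      T.card + Module.finrank F (Submodule.span F (Set.range fun i : Option (ZMod p) × {w : Fin 2 → ZMod p // w ≠ 0} =>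
        fun s : {s : {s : CMat p 2 // ∃ a ∈ H₁, ∃ b ∈ H₂, ∃ g ∈ H₃, s = ((a * b * g : GLm p 2) : Mat p 2)} //
          s ∉ T} => if ((s : _) : CMat p 2).mulVec (i.1.elim ![1, 0] fun j => ![j, 1]) = i.2.1 then (1 : F) else 0)) +
        2 * p) :
    ¬ ∃ c : Matrix (Fin 2) (Fin 2) (ZMod p) → ℂ, (∀ M, 1 < M.rank → c M = 0) ∧
      (∑ M, c M * ZMod.stdAddChar (Matrix.trace (M * ((1 : GLm p 2) : Mat p 2)))) = 1 ∧
      ∀ a ∈ H₁, ∀ b ∈ H₂, ∀ g ∈ H₃, a * b * g ≠ 1 →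
        (∑ M, c M * ZMod.stdAddChar
          (Matrix.trace (M * ((a * b * g : GLm p 2) : Mat p 2)))) = 0 := by
  refine GlobalRelations.no_levelOne_design_of_rank (L := Option (ZMod p))
    (fun o => o.elim ![1, 0] fun j => ![j, 1]) standardLines_cover standardLines_ne_zero standardLines_inj
    H₁ H₂ H₃ T hT F ?_
  rw [card_rows, Fintype.card_option, ZMod.card]
  simpa using hlt

/-- `TwoRankCriterion.no_levelOne_design_of_twoRank` with the standard line family and `|L × {w ≠ 0}| = (p+1)(p²-1)` evaluated: the
literal FL check of `verify_lker.py` (`k` independent integer relations `α` among the standard rows of `S`, certified in the lker file). -/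
theorem no_levelOne_design_of_twoRank_std (H₁ H₂ H₃ : Subgroup (GLm p 2))
    (T : Finset {s : CMat p 2 // ∃ a ∈ H₁, ∃ b ∈ H₂, ∃ g ∈ H₃, s = ((a * b * g : GLm p 2) : Mat p 2)})
    (hT : ∀ x ∈ T, ∃ a₀ ∈ H₁, ∃ g₀ ∈ H₃, (x : CMat p 2) = ((a₀ * g₀ : GLm p 2) : Mat p 2))
    {k : ℕ} (α : Fin k → (Option (ZMod p) × {w : Fin 2 → ZMod p // w ≠ 0} → ℤ)) (hα : LinearIndependent ℤ α)
    (hrel : ∀ j, ∀ s : {s : CMat p 2 // ∃ a ∈ H₁, ∃ b ∈ H₂, ∃ g ∈ H₃, s = ((a * b * g : GLm p 2) : Mat p 2)},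
      ∑ i : Option (ZMod p) × {w : Fin 2 → ZMod p // w ≠ 0},
        α j i * (if (s : CMat p 2).mulVec (i.1.elim ![1, 0] fun j => ![j, 1]) = i.2.1 then (1 : ℤ) else 0) = 0)
    (F : Type*) [Field F]
    (hlt : (p + 1) * (p ^ 2 - 1) <
      T.card + Module.finrank F (Submodule.span F (Set.range fun i : Option (ZMod p) × {w : Fin 2 → ZMod p // w ≠ 0} =>
        fun s : {s : {s : CMat p 2 // ∃ a ∈ H₁, ∃ b ∈ H₂, ∃ g ∈ H₃, s = ((a * b * g : GLm p 2) : Mat p 2)} //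
          s ∉ T} => if ((s : _) : CMat p 2).mulVec (i.1.elim ![1, 0] fun j => ![j, 1]) = i.2.1 then (1 : F) else 0)) + k) :
    ¬ ∃ c : Matrix (Fin 2) (Fin 2) (ZMod p) → ℂ, (∀ M, 1 < M.rank → c M = 0) ∧
      (∑ M, c M * ZMod.stdAddChar (Matrix.trace (M * ((1 : GLm p 2) : Mat p 2)))) = 1 ∧
      ∀ a ∈ H₁, ∀ b ∈ H₂, ∀ g ∈ H₃, a * b * g ≠ 1 →
        (∑ M, c M * ZMod.stdAddChar
          (Matrix.trace (M * ((a * b * g : GLm p 2) : Mat p 2)))) = 0 := by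
  refine TwoRankCriterion.no_levelOne_design_of_twoRank (L := Option (ZMod p))
    (fun o => o.elim ![1, 0] fun j => ![j, 1]) standardLines_cover H₁ H₂ H₃ T hT α hα hrel F ?_
  rw [card_rows]
  exact hlt

/-- **PAIR WALL (H₁,H₃).**  If `H₁ ∩ H₃ = 1` and `|H₁|·|H₃| + 2p > (p+1)(p²-1)` (i.e. `|H₁||H₃| > 1418` for `p = 11`), there is no
level-one identity design for `(H₁,H₂,H₃)`, whatever `H₂`. -/
theorem no_levelOne_design_of_wall₁₃ (H₁ H₂ H₃ : Subgroup (GLm p 2)) (hdisj : Disjoint H₁ H₃)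
    (hlt : (p + 1) * (p ^ 2 - 1) < Nat.card H₁ * Nat.card H₃ + 2 * p) :
    ¬ ∃ c : Matrix (Fin 2) (Fin 2) (ZMod p) → ℂ, (∀ M, 1 < M.rank → c M = 0) ∧
      (∑ M, c M * ZMod.stdAddChar (Matrix.trace (M * ((1 : GLm p 2) : Mat p 2)))) = 1 ∧
      ∀ a ∈ H₁, ∀ b ∈ H₂, ∀ g ∈ H₃, a * b * g ≠ 1 →
        (∑ M, c M * ZMod.stdAddChar
          (Matrix.trace (M * ((a * b * g : GLm p 2) : Mat p 2)))) = 0 := by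
  -- the products a g as a Finset of the column subtype
  let f : H₁ × H₃ → {s : CMat p 2 // ∃ a ∈ H₁, ∃ b ∈ H₂, ∃ g ∈ H₃, s = ((a * b * g : GLm p 2) : Mat p 2)} :=
    fun x => ⟨(((x.1 : GLm p 2) * (x.2 : GLm p 2) : GLm p 2) : Mat p 2),
      ⟨x.1, x.1.2, 1, H₂.one_mem, x.2, x.2.2, by rw [mul_one]⟩⟩
  have hf : Function.Injective f := by
    rintro ⟨a, g⟩ ⟨a', g'⟩ hxy
    have hval : (((a : GLm p 2) * (g : GLm p 2) : GLm p 2) : Mat p 2) =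
        (((a' : GLm p 2) * (g' : GLm p 2) : GLm p 2) : Mat p 2) := congrArg Subtype.val hxy
    have h : (a : GLm p 2) * g = a' * g' := Units.ext hval
    have hx : (a' : GLm p 2)⁻¹ * a = g' * (g : GLm p 2)⁻¹ := by
      calc (a' : GLm p 2)⁻¹ * a = (a' : GLm p 2)⁻¹ * ((a : GLm p 2) * g) * (g : GLm p 2)⁻¹ := by group
        _ = (a' : GLm p 2)⁻¹ * ((a' : GLm p 2) * g') * (g : GLm p 2)⁻¹ := by rw [h]
        _ = g' * (g : GLm p 2)⁻¹ := by group
    have hx1 : (a' : GLm p 2)⁻¹ * a ∈ H₁ := H₁.mul_mem (H₁.inv_mem a'.2) a.2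
    have hx3 : (a' : GLm p 2)⁻¹ * a ∈ H₃ := by rw [hx]; exact H₃.mul_mem g'.2 (H₃.inv_mem g.2)
    have hone : (a' : GLm p 2)⁻¹ * a = 1 := hdisj.le_bot (Subgroup.mem_inf.mpr ⟨hx1, hx3⟩)
    have ha : (a : GLm p 2) = a' := by
      have h2 : (a' : GLm p 2) * ((a' : GLm p 2)⁻¹ * a) = (a' : GLm p 2) * 1 := by rw [hone]
      rw [← mul_assoc, mul_inv_cancel, one_mul, mul_one] at h2
      exact h2
    have hg : (g : GLm p 2) = g' := by
      rw [ha] at h; exact mul_left_cancel h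
    exact Prod.ext (Subtype.ext ha) (Subtype.ext hg)
  let T := (Finset.univ : Finset (H₁ × H₃)).image f
  have hTcard : T.card = Nat.card H₁ * Nat.card H₃ := by
    rw [Finset.card_image_of_injective _ hf, Finset.card_univ, Fintype.card_prod,
      Nat.card_eq_fintype_card, Nat.card_eq_fintype_card]
  have hT : ∀ x ∈ T, ∃ a₀ ∈ H₁, ∃ g₀ ∈ H₃, (x : CMat p 2) = ((a₀ * g₀ : GLm p 2) : Mat p 2) := by
    intro x hx
    obtain ⟨⟨a, g⟩, -, rfl⟩ := Finset.mem_image.mp hx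
    exact ⟨a, a.2, g, g.2, rfl⟩
  refine GlobalRelations.no_levelOne_design_of_rank (L := Option (ZMod p))
    (fun o => o.elim ![1, 0] fun j => ![j, 1]) standardLines_cover standardLines_ne_zero standardLines_inj
    H₁ H₂ H₃ T hT ℚ ?_
  rw [card_rows, hTcard, Fintype.card_option, ZMod.card]
  have h0 : 0 ≤ Module.finrank ℚ (Submodule.span ℚ (Set.range fun i : Option (ZMod p) × {w : Fin 2 → ZMod p // w ≠ 0} =>
      fun s : {s : {s : CMat p 2 // ∃ a ∈ H₁, ∃ b ∈ H₂, ∃ g ∈ H₃, s = ((a * b * g : GLm p 2) : Mat p 2)} //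
        s ∉ T} => if ((s : _) : CMat p 2).mulVec ((i.1.elim ![1, 0] fun j => ![j, 1])) = i.2.1 then (1 : ℚ) else 0)) :=
    Nat.zero_le _
  omega

/-- **PAIR WALL (H₁,H₂)** (via `design_restrict₁₂`). -/
theorem no_levelOne_design_of_wall₁₂ (H₁ H₂ H₃ : Subgroup (GLm p 2)) (hdisj : Disjoint H₁ H₂)
    (hlt : (p + 1) * (p ^ 2 - 1) < Nat.card H₁ * Nat.card H₂ + 2 * p) :
    ¬ ∃ c : Matrix (Fin 2) (Fin 2) (ZMod p) → ℂ, (∀ M, 1 < M.rank → c M = 0) ∧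
      (∑ M, c M * ZMod.stdAddChar (Matrix.trace (M * ((1 : GLm p 2) : Mat p 2)))) = 1 ∧
      ∀ a ∈ H₁, ∀ b ∈ H₂, ∀ g ∈ H₃, a * b * g ≠ 1 →
        (∑ M, c M * ZMod.stdAddChar
          (Matrix.trace (M * ((a * b * g : GLm p 2) : Mat p 2)))) = 0 :=
  fun h => no_levelOne_design_of_wall₁₃ H₁ ⊥ H₂ hdisj hlt (design_restrict₁₂ H₁ H₂ H₃ h)

/-- **PAIR WALL (H₂,H₃)** (via `design_restrict₂₃`). -/
theorem no_levelOne_design_of_wall₂₃ (H₁ H₂ H₃ : Subgroup (GLm p 2)) (hdisj : Disjoint H₂ H₃)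
    (hlt : (p + 1) * (p ^ 2 - 1) < Nat.card H₂ * Nat.card H₃ + 2 * p) :
    ¬ ∃ c : Matrix (Fin 2) (Fin 2) (ZMod p) → ℂ, (∀ M, 1 < M.rank → c M = 0) ∧
      (∑ M, c M * ZMod.stdAddChar (Matrix.trace (M * ((1 : GLm p 2) : Mat p 2)))) = 1 ∧
      ∀ a ∈ H₁, ∀ b ∈ H₂, ∀ g ∈ H₃, a * b * g ≠ 1 →
        (∑ M, c M * ZMod.stdAddChar
          (Matrix.trace (M * ((a * b * g : GLm p 2) : Mat p 2)))) = 0 :=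
  fun h => no_levelOne_design_of_wall₁₃ H₂ ⊥ H₃ hdisj hlt (design_restrict₂₃ H₁ H₂ H₃ h)

/-- `SubgroupTPP` forces the three pairwise intersections to be trivial (`(x, x⁻¹, 1)`, `(x, 1, x⁻¹)`, `(1, x, x⁻¹)`). -/
theorem subgroupTPP_disjoint {G : Type*} [Group G] {H₁ H₂ H₃ : Subgroup G}
    (h : Literature.Barriers.MatrixMultiplication.SubgroupTPP H₁ H₂ H₃) :
    Disjoint H₁ H₂ ∧ Disjoint H₁ H₃ ∧ Disjoint H₂ H₃ := by
  refine ⟨?_, ?_, ?_⟩ <;> rw [Subgroup.disjoint_def] <;> intro x hx hx'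
  · exact (h x hx x⁻¹ (H₂.inv_mem hx') 1 H₃.one_mem (by simp)).1
  · exact (h x hx 1 H₂.one_mem x⁻¹ (H₃.inv_mem hx') (by simp)).1
  · exact (h 1 H₁.one_mem x hx x⁻¹ (H₃.inv_mem hx') (by simp)).2.1

/-- **THE ENGINE'S TPP TEST.**  For subgroups, `SubgroupTPP H₁ H₂ H₃` is equivalent to the two set conditions the census engine checks:
`H₁ ∩ H₃ = 1` and `H₂ ∩ H₁H₃ = {1}` (`abg = 1 ↔ b = a⁻¹g⁻¹ ∈ H₁H₃`). -/
theorem subgroupTPP_iff_sets {G : Type*} [Group G] (H₁ H₂ H₃ : Subgroup G) :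
    Literature.Barriers.MatrixMultiplication.SubgroupTPP H₁ H₂ H₃ ↔
      (∀ a ∈ H₁, ∀ g ∈ H₃, a * g = 1 → a = 1) ∧ (∀ a ∈ H₁, ∀ g ∈ H₃, a * g ∈ H₂ → a * g = 1) := by
  constructor
  · intro h
    refine ⟨fun a ha g hg h1 => (h a ha 1 H₂.one_mem g hg (by simpa using h1)).1, fun a ha g hg hmem => ?_⟩
    exact (h a⁻¹ (H₁.inv_mem ha) (a * g) hmem g⁻¹ (H₃.inv_mem hg) (by group)).2.1
  · rintro ⟨h13, h2⟩ a ha b hb g hg habg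
    have hb' : b = a⁻¹ * g⁻¹ := by
      calc b = a⁻¹ * (a * b * g) * g⁻¹ := by group
        _ = a⁻¹ * g⁻¹ := by rw [habg]; group
    have hag : a⁻¹ * g⁻¹ = 1 := h2 a⁻¹ (H₁.inv_mem ha) g⁻¹ (H₃.inv_mem hg) (hb' ▸ hb)
    have ha1 : a = 1 := by simpa using h13 a⁻¹ (H₁.inv_mem ha) g⁻¹ (H₃.inv_mem hg) hag
    refine ⟨ha1, by rw [hb', hag], ?_⟩
    rw [ha1, inv_one, one_mul, inv_eq_one] at hag
    exact hag

/-- **THE CENSUS WALLS UNDER THE CRUX'S OWN HYPOTHESIS.**  For a `SubgroupTPP` triple of `GL₂(𝔽_p)`, if ANY pair has `|Hᵢ|·|Hⱼ| + 2p > (p+1)(p²-1)`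
(`|Hᵢ||Hⱼ| > 1418` at `p = 11`), the identity-design clause of `SubgroupIdentityDesigns` fails at `(m,k) = (2,1)`. -/
theorem no_levelOne_design_of_walls (H₁ H₂ H₃ : Subgroup (GLm p 2))
    (htpp : Literature.Barriers.MatrixMultiplication.SubgroupTPP H₁ H₂ H₃)
    (hwall : (p + 1) * (p ^ 2 - 1) < Nat.card H₁ * Nat.card H₃ + 2 * p ∨
      (p + 1) * (p ^ 2 - 1) < Nat.card H₁ * Nat.card H₂ + 2 * p ∨
      (p + 1) * (p ^ 2 - 1) < Nat.card H₂ * Nat.card H₃ + 2 * p) :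
    ¬ ∃ c : Matrix (Fin 2) (Fin 2) (ZMod p) → ℂ, (∀ M, 1 < M.rank → c M = 0) ∧
      (∑ M, c M * ZMod.stdAddChar (Matrix.trace (M * ((1 : GLm p 2) : Mat p 2)))) = 1 ∧
      ∀ a ∈ H₁, ∀ b ∈ H₂, ∀ g ∈ H₃, a * b * g ≠ 1 →
        (∑ M, c M * ZMod.stdAddChar
          (Matrix.trace (M * ((a * b * g : GLm p 2) : Mat p 2)))) = 0 := by
  obtain ⟨h12, h13, h23⟩ := subgroupTPP_disjoint htpp
  rcases hwall with h | h | h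
  · exact no_levelOne_design_of_wall₁₃ H₁ H₂ H₃ h13 h
  · exact no_levelOne_design_of_wall₁₂ H₁ H₂ H₃ h12 h
  · exact no_levelOne_design_of_wall₂₃ H₁ H₂ H₃ h23 h

end StandardLines

end Summit.MatrixMultiplication.MatrixMultiplication.Theorems.SubgroupIdentityDesigns.Negative
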